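import Literature.NumberTheory.LFunctions.WeilFirstPrimeCertificateCCells0
import Literature.NumberTheory.LFunctions.WeilFirstPrimeCertificateCCells1
import Literature.NumberTheory.LFunctions.WeilFirstPrimeCertificateCCells2
import Literature.NumberTheory.LFunctions.WeilFirstPrimeCertificateCCells3
import Literature.NumberTheory.LFunctions.WeilFirstPrimeCertificateCCells4
import Literature.NumberTheory.LFunctions.WeilFirstPrimeCertificateCNu0
import Literature.NumberTheory.LFunctions.WeilFirstPrimeCertificateCNu1
import Literature.NumberTheory.LFunctions.WeilFirstPrimeCertificateCNu2
import Literature.NumberTheory.LFunctions.WeilFirstPrimeCertificateCNu3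
import Literature.NumberTheory.LFunctions.WeilFirstPrimeCertificateCNu4
import Literature.NumberTheory.LFunctions.WeilFirstPrimeCertificateCNu5
import Literature.NumberTheory.LFunctions.WeilFirstPrimeCertificateCNu6
import Literature.NumberTheory.LFunctions.WeilFirstPrimeCertificateCNu7
import Literature.NumberTheory.LFunctions.WeilFirstPrimeCertificateCNu8
import Literature.NumberTheory.LFunctions.WeilFirstPrimeCertificateCNu9
import Literature.NumberTheory.LFunctions.WeilFirstPrimeCertificateCNu10
import Literature.NumberTheory.LFunctions.WeilFirstPrimeCertificateCNu11
import Literature.NumberTheory.LFunctions.WeilFirstPrimeCertificateCNu12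
import Literature.NumberTheory.LFunctions.WeilFirstPrimeCertificateCNu13
import Literature.NumberTheory.LFunctions.WeilFirstPrimeCertificateCNu14
import Literature.NumberTheory.LFunctions.WeilFirstPrimeCertificateCNu15
import Literature.NumberTheory.LFunctions.WeilFirstPrimeCertificateCNu16
import Literature.NumberTheory.LFunctions.WeilFirstPrimeCertificateCBlock0
import Literature.NumberTheory.LFunctions.WeilFirstPrimeCertificateCBlock1
import HarnessLib

/-!
# First-prime Weil positivity, stage C: `weilCert3C.check = true` (assembly)

The Boolean `weilCert3C.check` from its kernel-checked parts: the cells (chunks `0`–`14`, plus the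
cheap chain, dyadic and level tests of `checkCells₃`), the scalar side conditions, the `100` even
scaled moments, and the two parity blocks.
-/

noncomputable section

namespace Literature.NumberTheory.LFunctions

/-- The chain test (cheap). [folklore] -/
theorem checkChain_weilCert3C : checkChain₂ weilCert3CCells 0 50 = true := by
  decide +kernel

set_option maxHeartbeats 0 in
/-- The level test at `T` against the integer digamma bound (one evaluation of `wLoZ`). [folklore] -/
theorem checkLevel_weilCert3C :
    decide ((1230683909815/549755813888 : ℚ) + cZeroFI.hiQ ≤ wLoZ 72 1600 5 2500) = true := by
  decide +kernel

/-- The dyadic representation of `T`. [folklore] -/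
theorem checkTdy_weilCert3C :
    (decide (1 ≤ 5) && decide ((50 : ℚ) * 2 ^ 5 = ((dyNum (50 : ℚ) 5 : ℕ) : ℚ))) = true := by
  decide +kernel

/-- `dyNum T j` evaluates to `1600`. [folklore] -/
theorem dyNumT_weilCert3C : dyNum (50 : ℚ) 5 = 1600 := by
  decide +kernel

/-- **Kernel check of the cells** (assembled from the chunks). [folklore] -/
theorem checkCells_weilCert3C :
    checkCells₃ weilCert3C.base.prec weilCert3C.j weilCert3C.base.wL weilCert3C.base.T weilCert3C.base.mwT weilCert3C.cells = true := by
  have hall : (weilCert3CCells.all fun c ↦ c.checkZ 72 5) = true := by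
    simp only [weilCert3CCells, List.all_append, checkCellsChunk0_weilCert3C, checkCellsChunk1_weilCert3C, checkCellsChunk2_weilCert3C, checkCellsChunk3_weilCert3C, checkCellsChunk4_weilCert3C, checkCellsChunk5_weilCert3C, checkCellsChunk6_weilCert3C, checkCellsChunk7_weilCert3C, checkCellsChunk8_weilCert3C, checkCellsChunk9_weilCert3C, checkCellsChunk10_weilCert3C, checkCellsChunk11_weilCert3C, checkCellsChunk12_weilCert3C, checkCellsChunk13_weilCert3C, checkCellsChunk14_weilCert3C, Bool.and_self]
  have h : checkCells₃ 72 5 (1230683909815/549755813888 : ℚ) (50 : ℚ) 2500 weilCert3CCells = true := by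
    unfold checkCells₃
    rw [checkChain_weilCert3C, hall, dyNumT_weilCert3C, checkLevel_weilCert3C]
    have hd := checkTdy_weilCert3C
    rw [dyNumT_weilCert3C] at hd
    rw [Bool.true_and, Bool.true_and]
    simpa using hd
  exact h

set_option maxHeartbeats 0 in
/-- **Kernel check of the scalar side conditions** (`0 < b ≤ a₀ ≤ 1`, …, `κ ≥ 0`). [folklore] -/
theorem checkScalars_weilCert3C : weilCert3C.checkScalars = true := by
  decide +kernel

/-- The claimed scaled moment table of the stage-C certificate is correct (even entries). [folklore] -/
theorem checkNu_weilCert3C : weilCert3C.checkNu = true := by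
  refine WeilCert2.allBelow_of_forall fun k hk ↦ ?_
  have hk' : k < 100 := hk
  interval_cases k
  · exact checkNuAt0_weilCert3C
  · exact checkNuAt2_weilCert3C
  · exact checkNuAt4_weilCert3C
  · exact checkNuAt6_weilCert3C
  · exact checkNuAt8_weilCert3C
  · exact checkNuAt10_weilCert3C
  · exact checkNuAt12_weilCert3C
  · exact checkNuAt14_weilCert3C
  · exact checkNuAt16_weilCert3C
  · exact checkNuAt18_weilCert3C
  · exact checkNuAt20_weilCert3C
  · exact checkNuAt22_weilCert3C
  · exact checkNuAt24_weilCert3C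
  · exact checkNuAt26_weilCert3C
  · exact checkNuAt28_weilCert3C
  · exact checkNuAt30_weilCert3C
  · exact checkNuAt32_weilCert3C
  · exact checkNuAt34_weilCert3C
  · exact checkNuAt36_weilCert3C
  · exact checkNuAt38_weilCert3C
  · exact checkNuAt40_weilCert3C
  · exact checkNuAt42_weilCert3C
  · exact checkNuAt44_weilCert3C
  · exact checkNuAt46_weilCert3C
  · exact checkNuAt48_weilCert3C
  · exact checkNuAt50_weilCert3C
  · exact checkNuAt52_weilCert3C
  · exact checkNuAt54_weilCert3C
  · exact checkNuAt56_weilCert3C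
  · exact checkNuAt58_weilCert3C
  · exact checkNuAt60_weilCert3C
  · exact checkNuAt62_weilCert3C
  · exact checkNuAt64_weilCert3C
  · exact checkNuAt66_weilCert3C
  · exact checkNuAt68_weilCert3C
  · exact checkNuAt70_weilCert3C
  · exact checkNuAt72_weilCert3C
  · exact checkNuAt74_weilCert3C
  · exact checkNuAt76_weilCert3C
  · exact checkNuAt78_weilCert3C
  · exact checkNuAt80_weilCert3C
  · exact checkNuAt82_weilCert3C
  · exact checkNuAt84_weilCert3C
  · exact checkNuAt86_weilCert3C
  · exact checkNuAt88_weilCert3C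
  · exact checkNuAt90_weilCert3C
  · exact checkNuAt92_weilCert3C
  · exact checkNuAt94_weilCert3C
  · exact checkNuAt96_weilCert3C
  · exact checkNuAt98_weilCert3C
  · exact checkNuAt100_weilCert3C
  · exact checkNuAt102_weilCert3C
  · exact checkNuAt104_weilCert3C
  · exact checkNuAt106_weilCert3C
  · exact checkNuAt108_weilCert3C
  · exact checkNuAt110_weilCert3C
  · exact checkNuAt112_weilCert3C
  · exact checkNuAt114_weilCert3C
  · exact checkNuAt116_weilCert3C
  · exact checkNuAt118_weilCert3C
  · exact checkNuAt120_weilCert3C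
  · exact checkNuAt122_weilCert3C
  · exact checkNuAt124_weilCert3C
  · exact checkNuAt126_weilCert3C
  · exact checkNuAt128_weilCert3C
  · exact checkNuAt130_weilCert3C
  · exact checkNuAt132_weilCert3C
  · exact checkNuAt134_weilCert3C
  · exact checkNuAt136_weilCert3C
  · exact checkNuAt138_weilCert3C
  · exact checkNuAt140_weilCert3C
  · exact checkNuAt142_weilCert3C
  · exact checkNuAt144_weilCert3C
  · exact checkNuAt146_weilCert3C
  · exact checkNuAt148_weilCert3C
  · exact checkNuAt150_weilCert3C
  · exact checkNuAt152_weilCert3C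
  · exact checkNuAt154_weilCert3C
  · exact checkNuAt156_weilCert3C
  · exact checkNuAt158_weilCert3C
  · exact checkNuAt160_weilCert3C
  · exact checkNuAt162_weilCert3C
  · exact checkNuAt164_weilCert3C
  · exact checkNuAt166_weilCert3C
  · exact checkNuAt168_weilCert3C
  · exact checkNuAt170_weilCert3C
  · exact checkNuAt172_weilCert3C
  · exact checkNuAt174_weilCert3C
  · exact checkNuAt176_weilCert3C
  · exact checkNuAt178_weilCert3C
  · exact checkNuAt180_weilCert3C
  · exact checkNuAt182_weilCert3C
  · exact checkNuAt184_weilCert3C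
  · exact checkNuAt186_weilCert3C
  · exact checkNuAt188_weilCert3C
  · exact checkNuAt190_weilCert3C
  · exact checkNuAt192_weilCert3C
  · exact checkNuAt194_weilCert3C
  · exact checkNuAt196_weilCert3C
  · exact checkNuAt198_weilCert3C

/-- **`weilCert3C.check = true`.** [folklore] -/
theorem check_weilCert3C : weilCert3C.check = true := by
  unfold WeilCert3.check
  rw [checkCells_weilCert3C, checkScalars_weilCert3C, checkNu_weilCert3C, checkBlock0_weilCert3C, checkBlock1_weilCert3C]
  rfl

end Literature.NumberTheory.LFunctions
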